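import Summits.CriticalPhenomena.PercolationContinuityZ3.Theorems.PercNearOneGluingNoHeavyLowerTailKnQuestion8CoefficientwiseCoreClassKernelMixMergedScheme
import Summits.CriticalPhenomena.PercolationContinuityZ3.Theorems.PercNearOneGluingNoHeavyLowerTailKnQuestion8CoefficientwiseCoreClassKernelMixBundleFibreTransfer
import Summits.CriticalPhenomena.PercolationContinuityZ3.Theorems.PercNearOneGluingNoHeavyLowerTailKnQuestion8CoefficientwiseCoreClassKernelMixBundleBoundaryTransfer
import HarnessLib

/-!
# Boundary inequality on bundles, X: the slab scheme as a set of landings and the TWO-CORNER THEOREM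

Support file (`--supports stmt-CriticalPhenomena-4575`, closed), prover `prim-cplus-coupling` (gen 57).  No definitions, no notations, no named facts,
no sorries; standard axioms.  Memo `prim-cplus-coupling/A5-COUPLING-gen56.md` §3.7 (TWO-CORNER THEOREM, pencil) and `A5-COUPLING-gen57.md` §2–§3.
Setting as in `…KernelMixBundleTwoFreeze` (explicit bundle, up-closed event `𝒱`, monotone `{0,1}` levels, DEMAND/SUPPLY regions, statuses).
* `Coefficientwise.bundle_slab_scheme_count` — ONE SLAB SCHEME (THEOREM BI's prefix-frozen flow for one type, memo gen 45 §3.9 (a)) with the landings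
  counted as a SET of points of the whole cube: slab thread `t` (blue at sources, red at landings), named threads `p, q` free or prefix-frozen; obtained from
  `fibre_system_count` with the event and `hro` read at the pre-lift `λ ∖ A t` and `t`-blue folded into `kbo` — no lift bookkeeping.
* `Coefficientwise.bundle_two_corner_count` — TWO-CORNER THEOREM (three threads `t₁, t₂, o`): if every type-1 source of `𝒱` has `t₁` blue and every type-2
  source has `t₂ ≠ t₁` blue then `#bad₁(𝒱) + #bad₂(𝒱) ≤ #(L₁ ∪ L₂)(𝒱)`; a common landing of the two slab schemes is full on `t₁, t₂`, so neither type froze the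
  other slab thread, giving sources of both types whose red clusters are `u` plus a leading run of `o` — comparable (`bundle_boundary_chain`), contradicting the
  `hᵃ/kᵃ` statuses.  (`t₁ = t₂` is THEOREM BI, `bundle_boundary_count`.)  Exact SAT cross-check TWOC/TWOCG (memo gen 56 §3.7).
[cite: KozmaNitzan2024, Questions 8–9 (§5.5 p. 36) (context); Harris 1960]
-/

namespace Summit.CriticalPhenomena.PercolationContinuityZ3.Theorems

open Finset Literature.Probability.Percolation

namespace Coefficientwise

variable {ι V : Type*}

open Classical in
/-- **One slab scheme, landings as a set.**  Explicit bundle, slab thread `t`, named threads `p, q` (`t, p, q` pairwise distinct) with fibre flags `SP, SQ`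
(frozen only if every type-1 source of `𝒱` with `t` blue starts red there).  Then `#{σ ⊆ E : A t ∩ σ = ∅, 𝒱, demand, hro, kbo} ≤ #{λ ⊆ E : A t ⊆ λ, 𝒱 (λ∖A t),
hro (λ∖A t), supply, L₁, red-starting & not full on the frozen threads}`.  Memo gen 45 §3.9 (a) / gen 57 §3.  [cite: KozmaNitzan2024, Questions 8–9 (§5.5 p. 36)
(context); Harris 1960] -/
theorem bundle_slab_scheme_count (ends : ι → Sym2 V) (r : ℕ) (L : ℕ → ℕ) (hL : ∀ t, t < r → 1 ≤ L t)
    (w : ℕ → ℕ → V) (e : ℕ → ℕ → ι) (u b : V)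
    (hw0 : ∀ t, t < r → w t 0 = u) (hwL : ∀ t, t < r → w t (L t) = b)
    (harc : ∀ t, t < r → ∀ j, 1 ≤ j → j ≤ L t → ends (e t j) = s(w t (j - 1), w t j))
    (hwinj : ∀ t, t < r → ∀ i j, i ≤ L t → j ≤ L t → w t i = w t j → i = j)
    (hcross : ∀ t t', t < r → t' < r → t ≠ t' → ∀ i j, i ≤ L t → j ≤ L t' → w t i = w t' j → (i = 0 ∧ j = 0) ∨ (i = L t ∧ j = L t'))
    (A : ℕ → Finset ι) (hA : ∀ t, t < r → ∀ i, i ∈ A t ↔ ∃ j, 1 ≤ j ∧ j ≤ L t ∧ e t j = i)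
    (hAdisj : ∀ t t', t < r → t' < r → t ≠ t' → Disjoint (A t) (A t'))
    (E : Finset ι) (hEA : ∀ i, i ∈ E ↔ ∃ t, t < r ∧ i ∈ A t)
    (t p q : ℕ) (ht : t < r) (hp : p < r) (hq : q < r) (htp : t ≠ p) (htq : t ≠ q) (hpq : p ≠ q)
    (𝒱 : Finset ι → Prop) (hV : ∀ ⦃s t : Finset ι⦄, s ⊆ t → 𝒱 s → 𝒱 t)
    (ha hb ka kb : Set V → ℝ) (mha : Monotone ha) (mhb : Monotone hb) (mka : Monotone ka) (mkb : Monotone kb)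
    (ha01 : ∀ S, ha S = 0 ∨ ha S = 1) (hb01 : ∀ S, hb S = 0 ∨ hb S = 1) (ka01 : ∀ S, ka S = 0 ∨ ka S = 1) (kb01 : ∀ S, kb S = 0 ∨ kb S = 1)
    (SP SQ : Finset ℕ) (hSP : SP = {0} ∨ SP = Finset.Icc 1 (L p - 1)) (hSQ : SQ = {0} ∨ SQ = Finset.Icc 1 (L q - 1))
    (covP : SP = Finset.Icc 1 (L p - 1) → ∀ σ, σ ⊆ E → Disjoint (A t) σ →
      (𝒱 σ ∧ (b ∈ openCluster (ends '' (↑(E \ σ) : Set ι)) u ∧ b ∉ openCluster (ends '' (↑σ : Set ι)) u) ∧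
        (ha (openCluster (ends '' (↑σ : Set ι)) u) = 1 ∧ hb (openCluster (ends '' (↑(E \ σ) : Set ι)) u) = 0) ∧
        (kb (openCluster (ends '' (↑(E \ σ) : Set ι)) u) = 1 ∧ ka (openCluster (ends '' (↑σ : Set ι)) u) = 0)) → e p 1 ∈ σ)
    (covQ : SQ = Finset.Icc 1 (L q - 1) → ∀ σ, σ ⊆ E → Disjoint (A t) σ →
      (𝒱 σ ∧ (b ∈ openCluster (ends '' (↑(E \ σ) : Set ι)) u ∧ b ∉ openCluster (ends '' (↑σ : Set ι)) u) ∧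
        (ha (openCluster (ends '' (↑σ : Set ι)) u) = 1 ∧ hb (openCluster (ends '' (↑(E \ σ) : Set ι)) u) = 0) ∧
        (kb (openCluster (ends '' (↑(E \ σ) : Set ι)) u) = 1 ∧ ka (openCluster (ends '' (↑σ : Set ι)) u) = 0)) → e q 1 ∈ σ) :
    ((E.powerset).filter (fun σ => Disjoint (A t) σ ∧ 𝒱 σ ∧
        (b ∈ openCluster (ends '' (↑(E \ σ) : Set ι)) u ∧ b ∉ openCluster (ends '' (↑σ : Set ι)) u) ∧
        (ha (openCluster (ends '' (↑σ : Set ι)) u) = 1 ∧ hb (openCluster (ends '' (↑(E \ σ) : Set ι)) u) = 0) ∧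
        (kb (openCluster (ends '' (↑(E \ σ) : Set ι)) u) = 1 ∧ ka (openCluster (ends '' (↑σ : Set ι)) u) = 0))).card
    ≤ ((E.powerset).filter (fun lam => A t ⊆ lam ∧ 𝒱 (lam \ A t) ∧
        (ha (openCluster (ends '' (↑(lam \ A t) : Set ι)) u) = 1 ∧ hb (openCluster (ends '' (↑(E \ (lam \ A t)) : Set ι)) u) = 0) ∧
        (b ∈ openCluster (ends '' (↑lam : Set ι)) u ∧ b ∉ openCluster (ends '' (↑(E \ lam) : Set ι)) u) ∧
        (ha (openCluster (ends '' (↑lam : Set ι)) u) = 1 ∧ kb (openCluster (ends '' (↑lam : Set ι)) u) = 1 ∧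
          hb (openCluster (ends '' (↑(E \ lam) : Set ι)) u) = 0 ∧ ka (openCluster (ends '' (↑(E \ lam) : Set ι)) u) = 0) ∧
        (SP = Finset.Icc 1 (L p - 1) → e p 1 ∈ lam ∧ ¬ A p ⊆ lam) ∧ (SQ = Finset.Icc 1 (L q - 1) → e q 1 ∈ lam ∧ ¬ A q ⊆ lam))).card := by
  set C : Finset ι → Set V := fun ω => openCluster (ends '' (↑ω : Set ι)) u with hC
  -- ## bundle bookkeeping
  have hr : 0 < r := lt_of_le_of_lt (Nat.zero_le p) hp
  have hAE : ∀ t, t < r → A t ⊆ E := fun t ht i hi => (hEA i).mpr ⟨t, ht, hi⟩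
  have heA : ∀ t, t < r → ∀ j, 1 ≤ j → j ≤ L t → e t j ∈ A t := fun t ht j hj1 hjL => (hA t ht _).mpr ⟨j, hj1, hjL, rfl⟩
  have full_iff : ∀ ω : Finset ι, ω ⊆ E → (b ∈ C ω ↔ ∃ t, t < r ∧ A t ⊆ ω) := fun ω hω =>
    bundle_b_mem_cluster_iff_threads ends r L hL w e u b hr hw0 hwL harc hwinj hcross A hA E hEA ω hω
  have einj : ∀ t, t < r → ∀ i j, 1 ≤ i → i ≤ L t → 1 ≤ j → j ≤ L t → e t i = e t j → i = j := by
    intro t ht i j hi1 hiL hj1 hjL hij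
    have h := harc t ht i hi1 hiL
    rw [hij, harc t ht j hj1 hjL] at h
    rcases Sym2.eq_iff.mp h with ⟨h1, _⟩ | ⟨h1, h2⟩
    · have := hwinj t ht (j - 1) (i - 1) (by omega) (by omega) h1; omega
    · have e1 := hwinj t ht (j - 1) i (by omega) hiL h1; have e2 := hwinj t ht j (i - 1) hjL (by omega) h2; omega
  have one_of_ge : ∀ (f : Set V → ℝ), (∀ S, f S = 0 ∨ f S = 1) → ∀ S S' : Set V, S ⊆ S' → Monotone f → f S = 1 → f S' = 1 := by
    intro f f01 S S' hSS' mf h1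
    rcases f01 S' with h0 | h0
    · have := mf hSS'; rw [h1, h0] at this; linarith
    · exact h0
  have zero_of_le : ∀ (f : Set V → ℝ), (∀ S, f S = 0 ∨ f S = 1) → ∀ S S' : Set V, S ⊆ S' → Monotone f → f S' = 0 → f S = 0 :=
    fun f f01 S S' hSS' mf h0 => (f01 S).elim id fun h1 => by have := mf hSS'; rw [h1, h0] at this; linarith
  have Cmono : ∀ s t : Finset ι, s ⊆ t → C s ⊆ C t := fun s t hst => openCluster_image_mono ends hst u
  have Ccompl : ∀ s t : Finset ι, s ⊆ t → C (E \ t) ⊆ C (E \ s) := fun s t hst => Cmono _ _ (Finset.sdiff_subset_sdiff (le_refl E) hst)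
  -- ## the predicates of the abstract theorem: the event and hro are read at the pre-lift `λ ∖ A t`, `t`-blue is folded into kbo
  have V'_mono : ∀ s s' : Finset ι, s ⊆ s' → 𝒱 (s \ A t) → 𝒱 (s' \ A t) :=
    fun s s' hss' hs => hV (Finset.sdiff_subset_sdiff hss' (le_refl _)) hs
  have hro_mono : ∀ s s' : Finset ι, s ⊆ s' → (ha (C (s \ A t)) = 1 ∧ hb (C (E \ (s \ A t))) = 0) →
      (ha (C (s' \ A t)) = 1 ∧ hb (C (E \ (s' \ A t))) = 0) := by
    intro s s' hss' hs
    have hsub : s \ A t ⊆ s' \ A t := Finset.sdiff_subset_sdiff hss' (le_refl _)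
    exact ⟨one_of_ge ha ha01 _ _ (Cmono _ _ hsub) mha hs.1, zero_of_le hb hb01 _ _ (Ccompl _ _ hsub) mhb hs.2⟩
  have kbo_anti : ∀ s s' : Finset ι, s ⊆ s' → ((kb (C (E \ s')) = 1 ∧ ka (C s') = 0) ∧ Disjoint (A t) s') →
      ((kb (C (E \ s)) = 1 ∧ ka (C s) = 0) ∧ Disjoint (A t) s) := by
    intro s s' hss' hs
    exact ⟨⟨one_of_ge kb kb01 _ _ (Ccompl s s' hss') mkb hs.1.1, zero_of_le ka ka01 _ _ (Cmono s s' hss') mka hs.1.2⟩,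
      Finset.disjoint_of_subset_right hss' hs.2⟩
  have N_anti : ∀ s s' : Finset ι, s ⊆ s' → (b ∈ C (E \ s') ∧ b ∉ C s') → (b ∈ C (E \ s) ∧ b ∉ C s) :=
    fun s s' hss' hs => ⟨Ccompl s s' hss' hs.1, fun hm => hs.2 (Cmono s s' hss' hm)⟩
  have hNPQ : ∀ σ, σ ⊆ E → (b ∈ C (E \ σ) ∧ b ∉ C σ) → ¬ A p ⊆ σ ∧ ¬ A q ⊆ σ := fun σ hσ hN =>
    ⟨fun hsub => hN.2 ((full_iff σ hσ).mpr ⟨p, hp, hsub⟩), fun hsub => hN.2 ((full_iff σ hσ).mpr ⟨q, hq, hsub⟩)⟩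
  -- a `t`-blue colouring equals its pre-lift
  have sdiff_of_disj : ∀ σ : Finset ι, Disjoint (A t) σ → σ \ A t = σ := fun σ hd => Finset.sdiff_eq_self_of_disjoint hd.symm
  have covP' : SP = Finset.Icc 1 (L p - 1) → ∀ σ, σ ⊆ E → (𝒱 (σ \ A t) ∧ (b ∈ C (E \ σ) ∧ b ∉ C σ) ∧
      (ha (C (σ \ A t)) = 1 ∧ hb (C (E \ (σ \ A t))) = 0) ∧ ((kb (C (E \ σ)) = 1 ∧ ka (C σ) = 0) ∧ Disjoint (A t) σ)) → e p 1 ∈ σ := by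
    intro hS σ hσ hs
    have hd := hs.2.2.2.2
    have h' := hs; rw [sdiff_of_disj σ hd] at h'
    exact covP hS σ hσ hd ⟨h'.1, h'.2.1, h'.2.2.1, h'.2.2.2.1⟩
  have covQ' : SQ = Finset.Icc 1 (L q - 1) → ∀ σ, σ ⊆ E → (𝒱 (σ \ A t) ∧ (b ∈ C (E \ σ) ∧ b ∉ C σ) ∧
      (ha (C (σ \ A t)) = 1 ∧ hb (C (E \ (σ \ A t))) = 0) ∧ ((kb (C (E \ σ)) = 1 ∧ ka (C σ) = 0) ∧ Disjoint (A t) σ)) → e q 1 ∈ σ := by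
    intro hS σ hσ hs
    have hd := hs.2.2.2.2
    have h' := hs; rw [sdiff_of_disj σ hd] at h'
    exact covQ hS σ hσ hd ⟨h'.1, h'.2.1, h'.2.2.1, h'.2.2.2.1⟩
  -- ## transfer
  have transfer : ∀ a c : ℕ, a ∈ SP → c ∈ SQ → a < L p → c < L q → ∀ ξ ρ : Finset ι, ξ ⊆ E → ρ ⊆ E →
      (∀ j, 1 ≤ j → j ≤ a → e p j ∈ ξ ∧ e p j ∈ ρ) → (1 ≤ a → e p (a + 1) ∉ ξ ∧ e p (a + 1) ∉ ρ) →
      (∀ j, 1 ≤ j → j ≤ L p → (a = 0 ∨ a + 2 ≤ j) → (e p j ∈ ρ ↔ e p j ∉ ξ)) →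
      (∀ j, 1 ≤ j → j ≤ c → e q j ∈ ξ ∧ e q j ∈ ρ) → (1 ≤ c → e q (c + 1) ∉ ξ ∧ e q (c + 1) ∉ ρ) →
      (∀ j, 1 ≤ j → j ≤ L q → (c = 0 ∨ c + 2 ≤ j) → (e q j ∈ ρ ↔ e q j ∉ ξ)) →
      (∀ x, x ∈ E → x ∉ A p → x ∉ A q → (x ∈ ρ ↔ x ∉ ξ)) →
      𝒱 (ξ \ A t) → (ha (C (ξ \ A t)) = 1 ∧ hb (C (E \ (ξ \ A t))) = 0) → ((kb (C (E \ ρ)) = 1 ∧ ka (C ρ) = 0) ∧ Disjoint (A t) ρ) →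
      (b ∈ C (E \ ρ) ∧ b ∉ C ρ) →
      (A t ⊆ ξ ∧ 𝒱 (ξ \ A t) ∧ (ha (C (ξ \ A t)) = 1 ∧ hb (C (E \ (ξ \ A t))) = 0) ∧ (b ∈ C ξ ∧ b ∉ C (E \ ξ)) ∧
        (ha (C ξ) = 1 ∧ kb (C ξ) = 1 ∧ hb (C (E \ ξ)) = 0 ∧ ka (C (E \ ξ)) = 0) ∧
        (SP = Finset.Icc 1 (L p - 1) → e p 1 ∈ ξ ∧ ¬ A p ⊆ ξ) ∧ (SQ = Finset.Icc 1 (L q - 1) → e q 1 ∈ ξ ∧ ¬ A q ⊆ ξ)) := by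
    intro a c haS hcS haL hcL ξ ρ hξ hρ hPa hPa1 hPfree hQc hQc1 hQfree hrest hv hh hk hN
    obtain ⟨κ, hκ⟩ : ∃ f : ℕ → ℕ, f = fun _ => 2 := ⟨_, rfl⟩
    obtain ⟨al, hal⟩ : ∃ f : ℕ → ℕ, f = fun t => if t = p then a else if t = q then c else 0 := ⟨_, rfl⟩
    have halp : al p = a := by rw [hal]; simp
    have halq : al q = c := by rw [hal]; simp [hpq.symm]
    have halo : ∀ t, t ≠ p → t ≠ q → al t = 0 := by intro t htp htq; rw [hal]; simp [htp, htq]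
    have hnf : ∀ t, t < r → ∃ j, 1 ≤ j ∧ j ≤ L t ∧ e t j ∉ ρ := by
      intro t ht
      by_contra hno
      push Not at hno
      exact hN.2 ((full_iff ρ hρ).mpr ⟨t, ht, fun x hx => by
        obtain ⟨j, hj1, hjL, rfl⟩ := (hA t ht x).mp hx
        exact hno j hj1 hjL⟩)
    have hempty : ∃ t, t < r ∧ ∀ j, 1 ≤ j → j ≤ L t → e t j ∉ ρ := by
      obtain ⟨t, ht, hsub⟩ := (full_iff (E \ ρ) Finset.sdiff_subset).mp hN.1
      exact ⟨t, ht, fun j hj1 hjL => (Finset.mem_sdiff.mp (hsub (heA t ht j hj1 hjL))).2⟩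
    have key := bundle_fibre_transfer ends r L hL w e u b hw0 hwL harc hwinj hcross A hA E hEA κ al ξ ρ ξ hξ
      (fun t ht j hj1 hjL => by rw [hκ]; simp)
      (fun t ht h1 => by rw [hκ] at h1; exact absurd h1 (by norm_num))
      (fun t' ht' _ => by
        by_cases htp' : t' = p
        · subst htp'; rw [halp]; exact ⟨haL, hPa, hPa1, hPfree⟩
        by_cases htq' : t' = q
        · subst htq'; rw [halq]; exact ⟨hcL, hQc, hQc1, hQfree⟩
        rw [halo t' htp' htq']
        refine ⟨Nat.lt_of_lt_of_le Nat.zero_lt_one (hL t' ht'), fun j hj1 hj0 => by omega, fun h => by omega, fun j hj1 hjL _ => ?_⟩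
        have hx : e t' j ∈ E := hAE t' ht' (heA t' ht' j hj1 hjL)
        exact hrest (e t' j) hx (fun hm => Finset.disjoint_left.mp (hAdisj t' p ht' hp htp') (heA t' ht' j hj1 hjL) hm)
          (fun hm => Finset.disjoint_left.mp (hAdisj t' q ht' hq htq') (heA t' ht' j hj1 hjL) hm))
      (fun t ht => by rw [hκ]; exact Or.inr (Or.inr rfl)) hnf hempty
    obtain ⟨hbX, hbY, T2, T3⟩ := key
    -- thread `t` is blue in `ρ`, hence red in `ξ`
    have hAt : A t ⊆ ξ := by
      intro x hx
      obtain ⟨j, hj1, hjL, rfl⟩ := (hA t ht x).mp hx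
      have hxE : e t j ∈ E := hAE t ht hx
      have hnρ : e t j ∉ ρ := fun hm => Finset.disjoint_left.mp hk.2 hx hm
      by_contra hnξ
      exact hnρ ((hrest (e t j) hxE (fun hm => Finset.disjoint_left.mp (hAdisj t p ht hp htp) hx hm)
        (fun hm => Finset.disjoint_left.mp (hAdisj t q ht hq htq) hx hm)).mpr hnξ)
    have hsub : ξ \ A t ⊆ ξ := Finset.sdiff_subset
    refine ⟨hAt, hv, hh, ⟨hbX, hbY⟩, ⟨one_of_ge ha ha01 _ _ (Cmono _ _ hsub) mha hh.1, one_of_ge kb kb01 _ _ T2 mkb hk.1.1,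
      zero_of_le hb hb01 _ _ (Ccompl _ _ hsub) mhb hh.2, zero_of_le ka ka01 _ _ T3 mka hk.1.2⟩, ?_, ?_⟩
    · intro hS
      have ha1 : 1 ≤ a := by rw [hS, Finset.mem_Icc] at haS; exact haS.1
      exact ⟨(hPa 1 (le_refl 1) ha1).1, fun hsub' => (hPa1 ha1).1 (hsub' (heA p hp (a + 1) (by omega) (by omega)))⟩
    · intro hS
      have hc1 : 1 ≤ c := by rw [hS, Finset.mem_Icc] at hcS; exact hcS.1
      exact ⟨(hQc 1 (le_refl 1) hc1).1, fun hsub' => (hQc1 hc1).1 (hsub' (heA q hq (c + 1) (by omega) (by omega)))⟩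
  -- ## the abstract theorem
  have key := fibre_system_count E (A p) (A q) (hAE p hp) (hAE q hq) (hAdisj p q hp hq hpq) (L p) (L q) (hL p hp) (hL q hq) (e p) (e q)
    (heA p hp) (einj p hp) (fun x hx => (hA p hp x).mp hx) (heA q hq) (einj q hq) (fun x hx => (hA q hq x).mp hx)
    (fun ξ => 𝒱 (ξ \ A t)) (fun ξ => ha (C (ξ \ A t)) = 1 ∧ hb (C (E \ (ξ \ A t))) = 0)
    (fun ξ => (kb (C (E \ ξ)) = 1 ∧ ka (C ξ) = 0) ∧ Disjoint (A t) ξ)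
    (fun ξ => b ∈ C (E \ ξ) ∧ b ∉ C ξ)
    (fun lam => A t ⊆ lam ∧ 𝒱 (lam \ A t) ∧ (ha (C (lam \ A t)) = 1 ∧ hb (C (E \ (lam \ A t))) = 0) ∧ (b ∈ C lam ∧ b ∉ C (E \ lam)) ∧
      (ha (C lam) = 1 ∧ kb (C lam) = 1 ∧ hb (C (E \ lam)) = 0 ∧ ka (C (E \ lam)) = 0) ∧
      (SP = Finset.Icc 1 (L p - 1) → e p 1 ∈ lam ∧ ¬ A p ⊆ lam) ∧ (SQ = Finset.Icc 1 (L q - 1) → e q 1 ∈ lam ∧ ¬ A q ⊆ lam))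
    V'_mono hro_mono kbo_anti N_anti hNPQ SP SQ hSP hSQ covP' covQ' transfer
  -- the source sets agree: a `t`-blue colouring is its own pre-lift
  have e1 : (E.powerset).filter (fun σ => Disjoint (A t) σ ∧ 𝒱 σ ∧ (b ∈ C (E \ σ) ∧ b ∉ C σ) ∧ (ha (C σ) = 1 ∧ hb (C (E \ σ)) = 0) ∧
      (kb (C (E \ σ)) = 1 ∧ ka (C σ) = 0)) =
      (E.powerset).filter (fun σ => 𝒱 (σ \ A t) ∧ (b ∈ C (E \ σ) ∧ b ∉ C σ) ∧ (ha (C (σ \ A t)) = 1 ∧ hb (C (E \ (σ \ A t))) = 0) ∧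
        ((kb (C (E \ σ)) = 1 ∧ ka (C σ) = 0) ∧ Disjoint (A t) σ)) := by
    apply Finset.filter_congr
    intro σ _
    constructor
    · rintro ⟨hd, hv, hN, hh, hk⟩
      rw [sdiff_of_disj σ hd]
      exact ⟨hv, hN, hh, hk, hd⟩
    · rintro ⟨hv, hN, hh, hk, hd⟩
      rw [sdiff_of_disj σ hd] at hv hh
      exact ⟨hd, hv, hN, hh, hk⟩
  have e2 : ((E.powerset).filter (fun σ => Disjoint (A t) σ ∧ 𝒱 σ ∧ (b ∈ C (E \ σ) ∧ b ∉ C σ) ∧ (ha (C σ) = 1 ∧ hb (C (E \ σ)) = 0) ∧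
      (kb (C (E \ σ)) = 1 ∧ ka (C σ) = 0))).card ≤ ((E.powerset).filter (fun lam => A t ⊆ lam ∧ 𝒱 (lam \ A t) ∧
      (ha (C (lam \ A t)) = 1 ∧ hb (C (E \ (lam \ A t))) = 0) ∧ (b ∈ C lam ∧ b ∉ C (E \ lam)) ∧
      (ha (C lam) = 1 ∧ kb (C lam) = 1 ∧ hb (C (E \ lam)) = 0 ∧ ka (C (E \ lam)) = 0) ∧
      (SP = Finset.Icc 1 (L p - 1) → e p 1 ∈ lam ∧ ¬ A p ⊆ lam) ∧ (SQ = Finset.Icc 1 (L q - 1) → e q 1 ∈ lam ∧ ¬ A q ⊆ lam))).card := by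
    rw [e1]; convert key using 3
  convert e2 using 3

open Classical in
/-- **TWO-CORNER THEOREM (three threads, all 0/1 levels).**  Explicit bundle whose threads are exactly `t₁, t₂, o` (pairwise distinct).  Suppose every type-1
source of the up-closed event `𝒱` has thread `t₁` blue and every type-2 source has thread `t₂` blue.  Type 1 runs the slab-`t₁` scheme with flags `S₁₂` (thread
`t₂`) and `S₁ₒ` (thread `o`), type 2 the slab-`t₂` scheme with flags `S₂₁, S₂ₒ`, each thread frozen only if all sources of the type start red there, and a type NOT
freezing the other slab thread exhibits a source that does not start red there (`hB₁, hB₂`; automatic for the maximal freeze sets).  Then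
`#bad₁(𝒱) + #bad₂(𝒱) ≤ #(L₁ ∪ L₂)(𝒱)`.  Memo gen 56 §3.7, gen 57 §3.  [cite: KozmaNitzan2024, Questions 8–9 (§5.5 p. 36) (context); Harris 1960] -/
theorem bundle_two_corner_count (ends : ι → Sym2 V) (r : ℕ) (L : ℕ → ℕ) (hL : ∀ t, t < r → 1 ≤ L t)
    (w : ℕ → ℕ → V) (e : ℕ → ℕ → ι) (u b : V)
    (hw0 : ∀ t, t < r → w t 0 = u) (hwL : ∀ t, t < r → w t (L t) = b)
    (harc : ∀ t, t < r → ∀ j, 1 ≤ j → j ≤ L t → ends (e t j) = s(w t (j - 1), w t j))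
    (hwinj : ∀ t, t < r → ∀ i j, i ≤ L t → j ≤ L t → w t i = w t j → i = j)
    (hcross : ∀ t t', t < r → t' < r → t ≠ t' → ∀ i j, i ≤ L t → j ≤ L t' → w t i = w t' j → (i = 0 ∧ j = 0) ∨ (i = L t ∧ j = L t'))
    (A : ℕ → Finset ι) (hA : ∀ t, t < r → ∀ i, i ∈ A t ↔ ∃ j, 1 ≤ j ∧ j ≤ L t ∧ e t j = i)
    (hAdisj : ∀ t t', t < r → t' < r → t ≠ t' → Disjoint (A t) (A t'))
    (E : Finset ι) (hEA : ∀ i, i ∈ E ↔ ∃ t, t < r ∧ i ∈ A t)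
    (t₁ t₂ o : ℕ) (ht₁ : t₁ < r) (ht₂ : t₂ < r) (ho : o < r) (h12 : t₁ ≠ t₂) (h1o : t₁ ≠ o) (h2o : t₂ ≠ o)
    (hr3 : ∀ t, t < r → t = t₁ ∨ t = t₂ ∨ t = o)
    (𝒱 : Finset ι → Prop) (hV : ∀ ⦃s t : Finset ι⦄, s ⊆ t → 𝒱 s → 𝒱 t)
    (ha hb ka kb : Set V → ℝ) (mha : Monotone ha) (mhb : Monotone hb) (mka : Monotone ka) (mkb : Monotone kb)
    (ha01 : ∀ S, ha S = 0 ∨ ha S = 1) (hb01 : ∀ S, hb S = 0 ∨ hb S = 1) (ka01 : ∀ S, ka S = 0 ∨ ka S = 1) (kb01 : ∀ S, kb S = 0 ∨ kb S = 1)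
    (hE₁ : ∀ σ, σ ⊆ E → (𝒱 σ ∧ (b ∈ openCluster (ends '' (↑(E \ σ) : Set ι)) u ∧ b ∉ openCluster (ends '' (↑σ : Set ι)) u) ∧
        (ha (openCluster (ends '' (↑σ : Set ι)) u) = 1 ∧ hb (openCluster (ends '' (↑(E \ σ) : Set ι)) u) = 0) ∧
        (kb (openCluster (ends '' (↑(E \ σ) : Set ι)) u) = 1 ∧ ka (openCluster (ends '' (↑σ : Set ι)) u) = 0)) → Disjoint (A t₁) σ)
    (hE₂ : ∀ σ, σ ⊆ E → (𝒱 σ ∧ (b ∈ openCluster (ends '' (↑(E \ σ) : Set ι)) u ∧ b ∉ openCluster (ends '' (↑σ : Set ι)) u) ∧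
        (ka (openCluster (ends '' (↑σ : Set ι)) u) = 1 ∧ kb (openCluster (ends '' (↑(E \ σ) : Set ι)) u) = 0) ∧
        (hb (openCluster (ends '' (↑(E \ σ) : Set ι)) u) = 1 ∧ ha (openCluster (ends '' (↑σ : Set ι)) u) = 0)) → Disjoint (A t₂) σ)
    (S₁₂ S₁ₒ S₂₁ S₂ₒ : Finset ℕ)
    (hS₁₂ : S₁₂ = {0} ∨ S₁₂ = Finset.Icc 1 (L t₂ - 1)) (hS₁ₒ : S₁ₒ = {0} ∨ S₁ₒ = Finset.Icc 1 (L o - 1))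
    (hS₂₁ : S₂₁ = {0} ∨ S₂₁ = Finset.Icc 1 (L t₁ - 1)) (hS₂ₒ : S₂ₒ = {0} ∨ S₂ₒ = Finset.Icc 1 (L o - 1))
    (cov₁₂ : S₁₂ = Finset.Icc 1 (L t₂ - 1) → ∀ σ, σ ⊆ E → Disjoint (A t₁) σ →
      (𝒱 σ ∧ (b ∈ openCluster (ends '' (↑(E \ σ) : Set ι)) u ∧ b ∉ openCluster (ends '' (↑σ : Set ι)) u) ∧
        (ha (openCluster (ends '' (↑σ : Set ι)) u) = 1 ∧ hb (openCluster (ends '' (↑(E \ σ) : Set ι)) u) = 0) ∧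
        (kb (openCluster (ends '' (↑(E \ σ) : Set ι)) u) = 1 ∧ ka (openCluster (ends '' (↑σ : Set ι)) u) = 0)) → e t₂ 1 ∈ σ)
    (cov₁ₒ : S₁ₒ = Finset.Icc 1 (L o - 1) → ∀ σ, σ ⊆ E → Disjoint (A t₁) σ →
      (𝒱 σ ∧ (b ∈ openCluster (ends '' (↑(E \ σ) : Set ι)) u ∧ b ∉ openCluster (ends '' (↑σ : Set ι)) u) ∧
        (ha (openCluster (ends '' (↑σ : Set ι)) u) = 1 ∧ hb (openCluster (ends '' (↑(E \ σ) : Set ι)) u) = 0) ∧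
        (kb (openCluster (ends '' (↑(E \ σ) : Set ι)) u) = 1 ∧ ka (openCluster (ends '' (↑σ : Set ι)) u) = 0)) → e o 1 ∈ σ)
    (cov₂₁ : S₂₁ = Finset.Icc 1 (L t₁ - 1) → ∀ σ, σ ⊆ E → Disjoint (A t₂) σ →
      (𝒱 σ ∧ (b ∈ openCluster (ends '' (↑(E \ σ) : Set ι)) u ∧ b ∉ openCluster (ends '' (↑σ : Set ι)) u) ∧
        (ka (openCluster (ends '' (↑σ : Set ι)) u) = 1 ∧ kb (openCluster (ends '' (↑(E \ σ) : Set ι)) u) = 0) ∧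
        (hb (openCluster (ends '' (↑(E \ σ) : Set ι)) u) = 1 ∧ ha (openCluster (ends '' (↑σ : Set ι)) u) = 0)) → e t₁ 1 ∈ σ)
    (cov₂ₒ : S₂ₒ = Finset.Icc 1 (L o - 1) → ∀ σ, σ ⊆ E → Disjoint (A t₂) σ →
      (𝒱 σ ∧ (b ∈ openCluster (ends '' (↑(E \ σ) : Set ι)) u ∧ b ∉ openCluster (ends '' (↑σ : Set ι)) u) ∧
        (ka (openCluster (ends '' (↑σ : Set ι)) u) = 1 ∧ kb (openCluster (ends '' (↑(E \ σ) : Set ι)) u) = 0) ∧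
        (hb (openCluster (ends '' (↑(E \ σ) : Set ι)) u) = 1 ∧ ha (openCluster (ends '' (↑σ : Set ι)) u) = 0)) → e o 1 ∈ σ)
    (hB₁ : S₁₂ = {0} → ∃ σ, σ ⊆ E ∧ (𝒱 σ ∧ (b ∈ openCluster (ends '' (↑(E \ σ) : Set ι)) u ∧ b ∉ openCluster (ends '' (↑σ : Set ι)) u) ∧
        (ha (openCluster (ends '' (↑σ : Set ι)) u) = 1 ∧ hb (openCluster (ends '' (↑(E \ σ) : Set ι)) u) = 0) ∧
        (kb (openCluster (ends '' (↑(E \ σ) : Set ι)) u) = 1 ∧ ka (openCluster (ends '' (↑σ : Set ι)) u) = 0)) ∧ e t₂ 1 ∉ σ)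
    (hB₂ : S₂₁ = {0} → ∃ σ, σ ⊆ E ∧ (𝒱 σ ∧ (b ∈ openCluster (ends '' (↑(E \ σ) : Set ι)) u ∧ b ∉ openCluster (ends '' (↑σ : Set ι)) u) ∧
        (ka (openCluster (ends '' (↑σ : Set ι)) u) = 1 ∧ kb (openCluster (ends '' (↑(E \ σ) : Set ι)) u) = 0) ∧
        (hb (openCluster (ends '' (↑(E \ σ) : Set ι)) u) = 1 ∧ ha (openCluster (ends '' (↑σ : Set ι)) u) = 0)) ∧ e t₁ 1 ∉ σ) :
    ((E.powerset).filter (fun σ => 𝒱 σ ∧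
        (b ∈ openCluster (ends '' (↑(E \ σ) : Set ι)) u ∧ b ∉ openCluster (ends '' (↑σ : Set ι)) u) ∧
        (ha (openCluster (ends '' (↑σ : Set ι)) u) = 1 ∧ hb (openCluster (ends '' (↑(E \ σ) : Set ι)) u) = 0) ∧
        (kb (openCluster (ends '' (↑(E \ σ) : Set ι)) u) = 1 ∧ ka (openCluster (ends '' (↑σ : Set ι)) u) = 0))).card
    + ((E.powerset).filter (fun σ => 𝒱 σ ∧
        (b ∈ openCluster (ends '' (↑(E \ σ) : Set ι)) u ∧ b ∉ openCluster (ends '' (↑σ : Set ι)) u) ∧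
        (ka (openCluster (ends '' (↑σ : Set ι)) u) = 1 ∧ kb (openCluster (ends '' (↑(E \ σ) : Set ι)) u) = 0) ∧
        (hb (openCluster (ends '' (↑(E \ σ) : Set ι)) u) = 1 ∧ ha (openCluster (ends '' (↑σ : Set ι)) u) = 0))).card
    ≤ ((E.powerset).filter (fun lam => 𝒱 lam ∧
        (b ∈ openCluster (ends '' (↑lam : Set ι)) u ∧ b ∉ openCluster (ends '' (↑(E \ lam) : Set ι)) u) ∧
        ((ha (openCluster (ends '' (↑lam : Set ι)) u) = 1 ∧ kb (openCluster (ends '' (↑lam : Set ι)) u) = 1 ∧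
            hb (openCluster (ends '' (↑(E \ lam) : Set ι)) u) = 0 ∧ ka (openCluster (ends '' (↑(E \ lam) : Set ι)) u) = 0) ∨
          (ka (openCluster (ends '' (↑lam : Set ι)) u) = 1 ∧ hb (openCluster (ends '' (↑lam : Set ι)) u) = 1 ∧
            kb (openCluster (ends '' (↑(E \ lam) : Set ι)) u) = 0 ∧ ha (openCluster (ends '' (↑(E \ lam) : Set ι)) u) = 0)))).card := by
  set C : Finset ι → Set V := fun ω => openCluster (ends '' (↑ω : Set ι)) u with hC
  have hr : 0 < r := lt_of_le_of_lt (Nat.zero_le o) ho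
  have hAE : ∀ t, t < r → A t ⊆ E := fun t ht i hi => (hEA i).mpr ⟨t, ht, hi⟩
  have heA : ∀ t, t < r → ∀ j, 1 ≤ j → j ≤ L t → e t j ∈ A t := fun t ht j hj1 hjL => (hA t ht _).mpr ⟨j, hj1, hjL, rfl⟩
  have hE : ∀ i, i ∈ E → ∃ t, t < r ∧ ∃ j, 1 ≤ j ∧ j ≤ L t ∧ e t j = i := fun i hi => by
    obtain ⟨t, ht, hit⟩ := (hEA i).mp hi; exact ⟨t, ht, (hA t ht i).mp hit⟩
  have full_iff : ∀ ω : Finset ι, ω ⊆ E → (b ∈ C ω ↔ ∃ t, t < r ∧ A t ⊆ ω) := fun ω hω =>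
    bundle_b_mem_cluster_iff_threads ends r L hL w e u b hr hw0 hwL harc hwinj hcross A hA E hEA ω hω
  have one_of_ge : ∀ (f : Set V → ℝ), (∀ S, f S = 0 ∨ f S = 1) → ∀ S S' : Set V, S ⊆ S' → Monotone f → f S = 1 → f S' = 1 := by
    intro f f01 S S' hSS' mf h1
    rcases f01 S' with h0 | h0
    · have := mf hSS'; rw [h1, h0] at this; linarith
    · exact h0
  -- no full thread at a demand point
  have nofull : ∀ σ : Finset ι, σ ⊆ E → b ∉ C σ → ∀ t, t < r → ∃ j, 1 ≤ j ∧ j ≤ L t ∧ e t j ∉ σ := by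
    intro σ hσ hb' t ht
    by_contra hno
    push Not at hno
    exact hb' ((full_iff σ hσ).mpr ⟨t, ht, fun x hx => by
      obtain ⟨j, hj1, hjL, rfl⟩ := (hA t ht x).mp hx
      exact hno j hj1 hjL⟩)
  -- the two slab schemes
  have k₁ := bundle_slab_scheme_count ends r L hL w e u b hw0 hwL harc hwinj hcross A hA hAdisj E hEA t₁ t₂ o ht₁ ht₂ ho h12 h1o h2o 𝒱 hV
    ha hb ka kb mha mhb mka mkb ha01 hb01 ka01 kb01 S₁₂ S₁ₒ hS₁₂ hS₁ₒ cov₁₂ cov₁ₒ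
  have k₂ := bundle_slab_scheme_count ends r L hL w e u b hw0 hwL harc hwinj hcross A hA hAdisj E hEA t₂ t₁ o ht₂ ht₁ ho h12.symm h2o h1o 𝒱 hV
    ka kb ha hb mka mkb mha mhb ka01 kb01 ha01 hb01 S₂₁ S₂ₒ hS₂₁ hS₂ₒ cov₂₁ cov₂ₒ
  set M₁ : Finset (Finset ι) := (E.powerset).filter (fun lam => A t₁ ⊆ lam ∧ 𝒱 (lam \ A t₁) ∧
      (ha (C (lam \ A t₁)) = 1 ∧ hb (C (E \ (lam \ A t₁))) = 0) ∧ (b ∈ C lam ∧ b ∉ C (E \ lam)) ∧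
      (ha (C lam) = 1 ∧ kb (C lam) = 1 ∧ hb (C (E \ lam)) = 0 ∧ ka (C (E \ lam)) = 0) ∧
      (S₁₂ = Finset.Icc 1 (L t₂ - 1) → e t₂ 1 ∈ lam ∧ ¬ A t₂ ⊆ lam) ∧ (S₁ₒ = Finset.Icc 1 (L o - 1) → e o 1 ∈ lam ∧ ¬ A o ⊆ lam)) with hM₁
  set M₂ : Finset (Finset ι) := (E.powerset).filter (fun lam => A t₂ ⊆ lam ∧ 𝒱 (lam \ A t₂) ∧
      (ka (C (lam \ A t₂)) = 1 ∧ kb (C (E \ (lam \ A t₂))) = 0) ∧ (b ∈ C lam ∧ b ∉ C (E \ lam)) ∧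
      (ka (C lam) = 1 ∧ hb (C lam) = 1 ∧ kb (C (E \ lam)) = 0 ∧ ha (C (E \ lam)) = 0) ∧
      (S₂₁ = Finset.Icc 1 (L t₁ - 1) → e t₁ 1 ∈ lam ∧ ¬ A t₁ ⊆ lam) ∧ (S₂ₒ = Finset.Icc 1 (L o - 1) → e o 1 ∈ lam ∧ ¬ A o ⊆ lam)) with hM₂
  -- ## the chain lemma: a common landing forces comparable red clusters of a type-1 and a type-2 source
  have hdisj : Disjoint M₁ M₂ := by
    rw [Finset.disjoint_left]
    intro lam h1 h2
    rw [hM₁, Finset.mem_filter, Finset.mem_powerset] at h1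
    rw [hM₂, Finset.mem_filter, Finset.mem_powerset] at h2
    obtain ⟨-, hA1, -, -, -, -, f12, -⟩ := h1
    obtain ⟨-, hA2, -, -, -, -, f21, -⟩ := h2
    -- neither type froze the other slab thread
    have hs12 : S₁₂ = {0} := hS₁₂.elim id fun h => absurd hA2 (f12 h).2
    have hs21 : S₂₁ = {0} := hS₂₁.elim id fun h => absurd hA1 (f21 h).2
    obtain ⟨σ₁, hσ₁E, hs₁, hn₁⟩ := hB₁ hs12
    obtain ⟨σ₂, hσ₂E, hs₂, hn₂⟩ := hB₂ hs21
    have hd₁ : Disjoint (A t₁) σ₁ := hE₁ σ₁ hσ₁E hs₁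
    have hd₂ : Disjoint (A t₂) σ₂ := hE₂ σ₂ hσ₂E hs₂
    have hstart₁ : ∀ t, t < r → t ≠ o → e t 1 ∉ σ₁ := by
      intro t ht hto hm
      rcases hr3 t ht with rfl | rfl | rfl
      · exact Finset.disjoint_left.mp hd₁ (heA t ht 1 (le_refl 1) (hL t ht)) hm
      · exact hn₁ hm
      · exact hto rfl
    have hstart₂ : ∀ t, t < r → t ≠ o → e t 1 ∉ σ₂ := by
      intro t ht hto hm
      rcases hr3 t ht with rfl | rfl | rfl
      · exact hn₂ hm
      · exact Finset.disjoint_left.mp hd₂ (heA t ht 1 (le_refl 1) (hL t ht)) hm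
      · exact hto rfl
    have hcmp := bundle_boundary_chain ends r L w e u hw0 harc hwinj hcross E hE o σ₁ σ₂ hσ₁E hσ₂E
      (nofull σ₁ hσ₁E hs₁.2.1.2) (nofull σ₂ hσ₂E hs₂.2.1.2) hstart₁ hstart₂
    rcases hcmp with hsub | hsub
    · have h0 := hs₂.2.2.2.2
      rw [one_of_ge ha ha01 _ _ hsub mha hs₁.2.2.1.1] at h0; exact one_ne_zero h0
    · have h0 := hs₁.2.2.2.2
      rw [one_of_ge ka ka01 _ _ hsub mka hs₂.2.2.1.1] at h0; exact one_ne_zero h0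
  -- ## landings are targets
  have hsub : M₁ ∪ M₂ ⊆ (E.powerset).filter (fun lam => 𝒱 lam ∧ (b ∈ C lam ∧ b ∉ C (E \ lam)) ∧
      ((ha (C lam) = 1 ∧ kb (C lam) = 1 ∧ hb (C (E \ lam)) = 0 ∧ ka (C (E \ lam)) = 0) ∨
        (ka (C lam) = 1 ∧ hb (C lam) = 1 ∧ kb (C (E \ lam)) = 0 ∧ ha (C (E \ lam)) = 0))) := by
    intro lam hlam
    rcases Finset.mem_union.mp hlam with h | h
    · rw [hM₁, Finset.mem_filter] at h
      exact Finset.mem_filter.mpr ⟨h.1, hV Finset.sdiff_subset h.2.2.1, h.2.2.2.2.1, Or.inl h.2.2.2.2.2.1⟩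
    · rw [hM₂, Finset.mem_filter] at h
      exact Finset.mem_filter.mpr ⟨h.1, hV Finset.sdiff_subset h.2.2.1, h.2.2.2.2.1, Or.inr h.2.2.2.2.2.1⟩
  -- ## the sources of each type are all in its slab
  have e₁ : (E.powerset).filter (fun σ => 𝒱 σ ∧ (b ∈ C (E \ σ) ∧ b ∉ C σ) ∧ (ha (C σ) = 1 ∧ hb (C (E \ σ)) = 0) ∧
      (kb (C (E \ σ)) = 1 ∧ ka (C σ) = 0)) = (E.powerset).filter (fun σ => Disjoint (A t₁) σ ∧ 𝒱 σ ∧ (b ∈ C (E \ σ) ∧ b ∉ C σ) ∧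
      (ha (C σ) = 1 ∧ hb (C (E \ σ)) = 0) ∧ (kb (C (E \ σ)) = 1 ∧ ka (C σ) = 0)) := by
    apply Finset.filter_congr
    intro σ hσ
    rw [Finset.mem_powerset] at hσ
    exact ⟨fun h => ⟨hE₁ σ hσ h, h⟩, fun h => h.2⟩
  have e₂ : (E.powerset).filter (fun σ => 𝒱 σ ∧ (b ∈ C (E \ σ) ∧ b ∉ C σ) ∧ (ka (C σ) = 1 ∧ kb (C (E \ σ)) = 0) ∧
      (hb (C (E \ σ)) = 1 ∧ ha (C σ) = 0)) = (E.powerset).filter (fun σ => Disjoint (A t₂) σ ∧ 𝒱 σ ∧ (b ∈ C (E \ σ) ∧ b ∉ C σ) ∧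
      (ka (C σ) = 1 ∧ kb (C (E \ σ)) = 0) ∧ (hb (C (E \ σ)) = 1 ∧ ha (C σ) = 0)) := by
    apply Finset.filter_congr
    intro σ hσ
    rw [Finset.mem_powerset] at hσ
    exact ⟨fun h => ⟨hE₂ σ hσ h, h⟩, fun h => h.2⟩
  have b₁ : ((E.powerset).filter (fun σ => 𝒱 σ ∧ (b ∈ C (E \ σ) ∧ b ∉ C σ) ∧ (ha (C σ) = 1 ∧ hb (C (E \ σ)) = 0) ∧
      (kb (C (E \ σ)) = 1 ∧ ka (C σ) = 0))).card ≤ M₁.card := by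
    rw [e₁]; convert k₁ using 3
  have b₂ : ((E.powerset).filter (fun σ => 𝒱 σ ∧ (b ∈ C (E \ σ) ∧ b ∉ C σ) ∧ (ka (C σ) = 1 ∧ kb (C (E \ σ)) = 0) ∧
      (hb (C (E \ σ)) = 1 ∧ ha (C σ) = 0))).card ≤ M₂.card := by
    rw [e₂]; convert k₂ using 3
  have ecard := Finset.card_union_of_disjoint hdisj
  have c1 := Finset.card_le_card hsub
  have b₁' : ((E.powerset).filter (fun σ => 𝒱 σ ∧ (b ∈ openCluster (ends '' (↑(E \ σ) : Set ι)) u ∧ b ∉ openCluster (ends '' (↑σ : Set ι)) u) ∧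
      (ha (openCluster (ends '' (↑σ : Set ι)) u) = 1 ∧ hb (openCluster (ends '' (↑(E \ σ) : Set ι)) u) = 0) ∧
      (kb (openCluster (ends '' (↑(E \ σ) : Set ι)) u) = 1 ∧ ka (openCluster (ends '' (↑σ : Set ι)) u) = 0))).card ≤ M₁.card := by
    convert b₁ using 3
  have b₂' : ((E.powerset).filter (fun σ => 𝒱 σ ∧ (b ∈ openCluster (ends '' (↑(E \ σ) : Set ι)) u ∧ b ∉ openCluster (ends '' (↑σ : Set ι)) u) ∧
      (ka (openCluster (ends '' (↑σ : Set ι)) u) = 1 ∧ kb (openCluster (ends '' (↑(E \ σ) : Set ι)) u) = 0) ∧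
      (hb (openCluster (ends '' (↑(E \ σ) : Set ι)) u) = 1 ∧ ha (openCluster (ends '' (↑σ : Set ι)) u) = 0))).card ≤ M₂.card := by
    convert b₂ using 3
  have c1' : (M₁ ∪ M₂).card ≤ ((E.powerset).filter (fun lam => 𝒱 lam ∧
      (b ∈ openCluster (ends '' (↑lam : Set ι)) u ∧ b ∉ openCluster (ends '' (↑(E \ lam) : Set ι)) u) ∧
      ((ha (openCluster (ends '' (↑lam : Set ι)) u) = 1 ∧ kb (openCluster (ends '' (↑lam : Set ι)) u) = 1 ∧
          hb (openCluster (ends '' (↑(E \ lam) : Set ι)) u) = 0 ∧ ka (openCluster (ends '' (↑(E \ lam) : Set ι)) u) = 0) ∨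
        (ka (openCluster (ends '' (↑lam : Set ι)) u) = 1 ∧ hb (openCluster (ends '' (↑lam : Set ι)) u) = 1 ∧
          kb (openCluster (ends '' (↑(E \ lam) : Set ι)) u) = 0 ∧ ha (openCluster (ends '' (↑(E \ lam) : Set ι)) u) = 0)))).card := by
    convert c1 using 3
  omega

end Coefficientwise

end Summit.CriticalPhenomena.PercolationContinuityZ3.Theorems
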